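import Mathlib
import HarnessLib
import Summits.ValiantsHypothesis.ValiantsHypothesis.Theorems.LacunarySymmetroidMatrixDescartesOsculationLawCuspCubicNonMonicPrelim
import Summits.ValiantsHypothesis.ValiantsHypothesis.Theorems.LacunarySymmetroidMatrixDescartesOsculationLawCuspNonMonicCount

/-!
# ValiantsHypothesis / LacunarySymmetroid — crux `MatrixDescartes` (stmt-ValiantsHypothesis-18050, V1),
# line «osculation-law»: the NON-MONIC cubic cusp curve — the COUNT

The count half (β) of the rank-three column `(3, s)` (val-lit-p5 g11's programme): abstract counting theorem for
the osculation set of `Ψ(t,b) = a₃(t)b³ + a₂(t)b² + a₁(t)b + a₀(t)` with `a₃ ≢ 0` (at `(3,s)`: `a₃ = det G₂₂`).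
As in the monic file `…CuspCubicCount`, the set `osc` is taken ABSTRACTLY: on `osc` the Hessian condition is a
quadratic `R₂(t)b² + R₁(t)b + R₀(t) = 0` (`hout`; from a pseudo-division `a₃^k·H = Q·Ψ + R`), every positive point
of the curve with `a₃(t) ≠ 0` satisfying it lies in `osc` (`hin`), an abscissa `t > 0` at which `Ψ(t,·)` is the zero
polynomial carries the whole vertical ray (`hvert`: there `θ₁Ψ ≡ 0`, so `H(t,·) ≡ 0`), and `Ψ(t,·)` is real-rooted
wherever `a₃(t) ≠ 0` (`hreal`, a factorisation `a₃·∏(b − μᵢ)`; at `(3,s)` from the symmetric Schur complement).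
ROOT PERSISTENCE is PROVED here from `hreal` by Vieta signs (`sign_of_pos_root`, `exists_pos_root_of_sign`).

`nonmonic_cubic_curve_ncard_le` (**main**): if `osc` is finite then
`#osc ≤ |supp N| + |supp N′| + 3(|supp a₃| + |supp R₂| + |supp R₁| + |supp R₀| + |supp L₁| + |supp L₀|)` with
`L₁ = a₁R₂² − a₃R₀R₂ − a₂R₁R₂ + a₃R₁²`, `L₀ = a₀R₂² − a₂R₀R₂ + a₃R₀R₁`, `N = R₂L₀² − R₁L₀L₁ + R₀L₁²`,
`N′ = a₀R₁³ − a₁R₀R₁² + a₂R₀²R₁ − a₃R₀³`.  Strata: vertical abscissae are impossible (finiteness); `a₃(t) = 0`,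
`R₂(t) = 0`, `L₁(t) = 0`, `L₀(t) = 0` (resp. `R₁(t) = 0`, `R₀(t) = 0`) carry ≤ 3 ordinates; generic abscissae inject
into `Z₊(N)` (resp. `Z₊(N′)`); identically vanishing strata are open arcs over `{a₃ ≠ 0}` (persistence / root branch
through `disc_nonneg_of_factor_gen` / the ratio arcs), emptied by finiteness.

Honest framing: a located column piece of an UNREGISTERED V1 law line (ideator val-idea-2); `OsculationLaw` (all
`m`), `PeelInequality`, `MatrixDescartes`, Conjecture B and `VP ≠ VNP` are OPEN / NOT proved; nothing here is progress
on them.  No definitions, no named facts; Mathlib + the line's files only.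
-/

-- `Summit.ValiantsHypothesis.ValiantsHypothesis.…` is the tree's mandated single-conjunct layout (Sub = Summit).
set_option linter.dupNamespace false

noncomputable section

namespace Summit.ValiantsHypothesis.ValiantsHypothesis.Theorems.LacunarySymmetroidMatrixDescartes

open Polynomial Set
open scoped BigOperators

namespace OsculationCuspCubic

set_option maxHeartbeats 1600000 in
/-- **Non-monic cubic cusp curve — the count.**  See the module docstring. [folklore] -/
theorem nonmonic_cubic_curve_ncard_le (a₃ a₂ a₁ a₀ R₂ R₁ R₀ : ℝ[X]) (osc : Set (Fin 2 → ℝ)) (ha₃ : a₃ ≠ 0)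
    (hout : ∀ p ∈ osc, 0 < p 0 ∧ 0 < p 1 ∧
      a₃.eval (p 0) * p 1 ^ 3 + a₂.eval (p 0) * p 1 ^ 2 + a₁.eval (p 0) * p 1 + a₀.eval (p 0) = 0 ∧
      R₂.eval (p 0) * p 1 ^ 2 + R₁.eval (p 0) * p 1 + R₀.eval (p 0) = 0)
    (hin : ∀ t b : ℝ, 0 < t → 0 < b → a₃.eval t ≠ 0 →
      a₃.eval t * b ^ 3 + a₂.eval t * b ^ 2 + a₁.eval t * b + a₀.eval t = 0 →
      R₂.eval t * b ^ 2 + R₁.eval t * b + R₀.eval t = 0 → (![t, b] : Fin 2 → ℝ) ∈ osc)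
    (hvert : ∀ t : ℝ, 0 < t → a₃.eval t = 0 → a₂.eval t = 0 → a₁.eval t = 0 → a₀.eval t = 0 →
      ∀ b : ℝ, 0 < b → (![t, b] : Fin 2 → ℝ) ∈ osc)
    (hreal : ∀ t : ℝ, a₃.eval t ≠ 0 → ∃ μ₁ μ₂ μ₃ : ℝ, ∀ b : ℝ,
      a₃.eval t * b ^ 3 + a₂.eval t * b ^ 2 + a₁.eval t * b + a₀.eval t =
        a₃.eval t * ((b - μ₁) * (b - μ₂) * (b - μ₃)))
    (hfin : osc.Finite) :
    osc.ncard ≤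
      (R₂ * (a₀ * R₂ ^ 2 - a₂ * R₀ * R₂ + a₃ * R₀ * R₁) ^ 2
          - R₁ * (a₀ * R₂ ^ 2 - a₂ * R₀ * R₂ + a₃ * R₀ * R₁) * (a₁ * R₂ ^ 2 - a₃ * R₀ * R₂ - a₂ * R₁ * R₂ + a₃ * R₁ ^ 2)
          + R₀ * (a₁ * R₂ ^ 2 - a₃ * R₀ * R₂ - a₂ * R₁ * R₂ + a₃ * R₁ ^ 2) ^ 2).support.card
      + (a₀ * R₁ ^ 3 - a₁ * R₀ * R₁ ^ 2 + a₂ * R₀ ^ 2 * R₁ - a₃ * R₀ ^ 3).support.card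
      + 3 * (a₃.support.card + R₂.support.card + R₁.support.card + R₀.support.card
          + (a₁ * R₂ ^ 2 - a₃ * R₀ * R₂ - a₂ * R₁ * R₂ + a₃ * R₁ ^ 2).support.card
          + (a₀ * R₂ ^ 2 - a₂ * R₀ * R₂ + a₃ * R₀ * R₁).support.card) := by
  classical
  set L₁ : ℝ[X] := a₁ * R₂ ^ 2 - a₃ * R₀ * R₂ - a₂ * R₁ * R₂ + a₃ * R₁ ^ 2 with hL₁def
  set L₀ : ℝ[X] := a₀ * R₂ ^ 2 - a₂ * R₀ * R₂ + a₃ * R₀ * R₁ with hL₀def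
  set N : ℝ[X] := R₂ * L₀ ^ 2 - R₁ * L₀ * L₁ + R₀ * L₁ ^ 2 with hNdef
  set N' : ℝ[X] := a₀ * R₁ ^ 3 - a₁ * R₀ * R₁ ^ 2 + a₂ * R₀ ^ 2 * R₁ - a₃ * R₀ ^ 3 with hN'def
  -- shorthand consequences of membership
  have hpos0 : ∀ p ∈ osc, 0 < p 0 := fun p hp => (hout p hp).1
  have hpos1 : ∀ p ∈ osc, 0 < p 1 := fun p hp => (hout p hp).2.1
  have hcub : ∀ p ∈ osc,
      a₃.eval (p 0) * p 1 ^ 3 + a₂.eval (p 0) * p 1 ^ 2 + a₁.eval (p 0) * p 1 + a₀.eval (p 0) = 0 :=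
    fun p hp => (hout p hp).2.2.1
  have hR : ∀ p ∈ osc, R₂.eval (p 0) * p 1 ^ 2 + R₁.eval (p 0) * p 1 + R₀.eval (p 0) = 0 :=
    fun p hp => (hout p hp).2.2.2
  -- no vertical abscissae (finiteness)
  have hnv : ∀ p ∈ osc, ¬ (a₃.eval (p 0) = 0 ∧ a₂.eval (p 0) = 0 ∧ a₁.eval (p 0) = 0 ∧ a₀.eval (p 0) = 0) := by
    intro p hp hall
    obtain ⟨h3, h2, h1, h0⟩ := hall
    apply hfin.not_infinite
    exact OsculationCuspGen.infinite_of_vertical (p 0) (hvert (p 0) (hpos0 p hp) h3 h2 h1 h0)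
  -- the two Euclid identities, evaluated
  have hEuclid : ∀ t b : ℝ, R₂.eval t ^ 2 * (a₃.eval t * b ^ 3 + a₂.eval t * b ^ 2 + a₁.eval t * b + a₀.eval t) =
      (a₃.eval t * R₂.eval t * b + (a₂.eval t * R₂.eval t - a₃.eval t * R₁.eval t))
          * (R₂.eval t * b ^ 2 + R₁.eval t * b + R₀.eval t)
        + (L₁.eval t * b + L₀.eval t) := by
    intro t b; rw [hL₁def, hL₀def]; simp only [eval_add, eval_sub, eval_mul, eval_pow]; ring
  have hNq : ∀ t b : ℝ, L₁.eval t * b + L₀.eval t = 0 →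
      N.eval t = L₁.eval t ^ 2 * (R₂.eval t * b ^ 2 + R₁.eval t * b + R₀.eval t) := by
    intro t b h
    have h0 : L₀.eval t = -(L₁.eval t * b) := by linarith
    rw [hNdef]; simp only [eval_add, eval_sub, eval_mul, eval_pow]; rw [h0]; ring
  have hN'q : ∀ t b : ℝ, R₁.eval t * b + R₀.eval t = 0 →
      N'.eval t = R₁.eval t ^ 3 * (a₃.eval t * b ^ 3 + a₂.eval t * b ^ 2 + a₁.eval t * b + a₀.eval t) := by
    intro t b h
    have h0 : R₀.eval t = -(R₁.eval t * b) := by linarith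
    rw [hN'def]; simp only [eval_add, eval_sub, eval_mul, eval_pow]; rw [h0]; ring
  have hL : ∀ p ∈ osc, L₁.eval (p 0) * p 1 + L₀.eval (p 0) = 0 := by
    intro p hp
    have h := hEuclid (p 0) (p 1)
    rw [hcub p hp, hR p hp, mul_zero, mul_zero, zero_add] at h
    exact h.symm
  have hNroot : ∀ p ∈ osc, N.IsRoot (p 0) := by
    intro p hp
    rw [IsRoot.def, hNq (p 0) (p 1) (hL p hp), hR p hp, mul_zero]
  -- persistence from Vieta signs: a point with `a₃(t₀) ≠ 0` and `R ≡ 0 near it` spans an open arc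
  have persist_arc : ∀ p ∈ osc, a₃.eval (p 0) ≠ 0 →
      (∀ t b : ℝ, R₂.eval t * b ^ 2 + R₁.eval t * b + R₀.eval t = 0) → False := by
    intro p hp ha hRz
    have hsign := sign_of_pos_root ha (hpos1 p hp) (hcub p hp)
    have hc2 : Continuous fun t => a₂.eval t * a₃.eval t := a₂.continuous.mul a₃.continuous
    have hc1 : Continuous fun t => a₁.eval t * a₃.eval t := a₁.continuous.mul a₃.continuous
    have hc0 : Continuous fun t => a₀.eval t * a₃.eval t := a₀.continuous.mul a₃.continuous
    set U : Set ℝ := {t | 0 < t} ∩ ({t | a₂.eval t * a₃.eval t < 0} ∪ {t | a₁.eval t * a₃.eval t < 0} ∪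
      {t | a₀.eval t * a₃.eval t < 0}) with hU
    have hUo : IsOpen U :=
      (isOpen_lt continuous_const continuous_id).inter
        (((isOpen_lt hc2 continuous_const).union (isOpen_lt hc1 continuous_const)).union
          (isOpen_lt hc0 continuous_const))
    have hex : ∀ t ∈ U, ∃ b : ℝ, 0 < b ∧
        a₃.eval t * b ^ 3 + a₂.eval t * b ^ 2 + a₁.eval t * b + a₀.eval t = 0 := by
      intro t ht
      have hs : a₂.eval t * a₃.eval t < 0 ∨ a₁.eval t * a₃.eval t < 0 ∨ a₀.eval t * a₃.eval t < 0 := by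
        rcases ht.2 with (h | h) | h
        · exact Or.inl h
        · exact Or.inr (Or.inl h)
        · exact Or.inr (Or.inr h)
      have hat : a₃.eval t ≠ 0 := by
        rcases hs with h | h | h <;>
        · intro h0; rw [h0, mul_zero] at h; exact lt_irrefl _ h
      exact exists_pos_root_of_sign hat (hreal t hat) hs
    apply hfin.not_infinite
    refine OsculationCusp.infinite_of_curve hUo (t₀ := p 0) ⟨hpos0 p hp, ?_⟩
      (fun t => if h : ∃ b : ℝ, 0 < b ∧
          a₃.eval t * b ^ 3 + a₂.eval t * b ^ 2 + a₁.eval t * b + a₀.eval t = 0 then h.choose else 0) ?_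
    · rcases hsign with h | h | h
      · exact Or.inl (Or.inl h)
      · exact Or.inl (Or.inr h)
      · exact Or.inr h
    · intro t ht
      have hh := hex t ht
      have hat : a₃.eval t ≠ 0 := by
        rcases ht.2 with (h | h) | h <;>
        · simp only [Set.mem_setOf_eq] at h
          intro h0; rw [h0, mul_zero] at h; exact lt_irrefl _ h
      simp only [dif_pos hh]
      exact hin t _ ht.1 hh.choose_spec.1 hat hh.choose_spec.2 (hRz t _)
  -- the empty case
  rcases Set.eq_empty_or_nonempty osc with hempty | hne
  · rw [hempty, Set.ncard_empty]; exact Nat.zero_le _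
  -- the stratum `a₃(t) = 0` (non-degenerate abscissae only, by `hnv`)
  set Sa : Set (Fin 2 → ℝ) := {p | p ∈ osc ∧ a₃.eval (p 0) = 0} with hSa
  set Sg : Set (Fin 2 → ℝ) := {p | p ∈ osc ∧ a₃.eval (p 0) ≠ 0} with hSg
  have hsplit0 : osc = Sa ∪ Sg := by
    ext p; simp only [hSa, hSg, Set.mem_union, Set.mem_setOf_eq]; tauto
  have hSac : Sa.ncard ≤ 3 * a₃.support.card :=
    fibre_three_le_gen a₃ a₂ a₁ a₀ a₃ ha₃ Sa (fun p hp => ⟨hpos0 p hp.1, hp.2, hcub p hp.1, hnv p hp.1⟩)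
  have hSgfin : Sg.Finite := hfin.subset (fun p hp => hp.1)
  -- the count on `Sg = {a₃ ≠ 0}`
  have hSgc : Sg.ncard ≤ N.support.card + N'.support.card
      + 3 * (R₂.support.card + R₁.support.card + R₀.support.card + L₁.support.card + L₀.support.card) := by
    rcases Set.eq_empty_or_nonempty Sg with hSge | hSgne
    · rw [hSge, Set.ncard_empty]; exact Nat.zero_le _
    have hVa : IsOpen {t : ℝ | a₃.eval t ≠ 0} := isOpen_ne_fun a₃.continuous continuous_const
    by_cases hR2 : R₂ = 0
    · /- LINEAR REGIME `R = R₁ b + R₀` -/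
      have hRlin : ∀ p ∈ osc, R₁.eval (p 0) * p 1 + R₀.eval (p 0) = 0 := by
        intro p hp; have h := hR p hp; rw [hR2, eval_zero, zero_mul, zero_add] at h; exact h
      have hN'root : ∀ p ∈ osc, N'.IsRoot (p 0) := by
        intro p hp
        rw [IsRoot.def, hN'q (p 0) (p 1) (hRlin p hp), hcub p hp, mul_zero]
      by_cases hR1 : R₁ = 0
      · by_cases hR0 : R₀ = 0
        · -- `R ≡ 0`: persistence empties `Sg`
          exfalso
          obtain ⟨p, hp⟩ := hSgne
          refine persist_arc p hp.1 hp.2 fun t b => ?_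
          rw [hR2, hR1, hR0, eval_zero]
          ring
        · have h := fibre_three_le_gen a₃ a₂ a₁ a₀ R₀ hR0 Sg
            (fun p hp => ⟨hpos0 p hp.1, ?_, hcub p hp.1, hnv p hp.1⟩)
          · nlinarith [h, Nat.zero_le N.support.card, Nat.zero_le N'.support.card, Nat.zero_le R₂.support.card,
              Nat.zero_le R₁.support.card, Nat.zero_le L₁.support.card, Nat.zero_le L₀.support.card]
          · have h1 := hRlin p hp.1
            rw [hR1, eval_zero, zero_mul, zero_add] at h1
            exact h1
      · set T0 : Set (Fin 2 → ℝ) := {p | p ∈ Sg ∧ R₁.eval (p 0) = 0} with hT0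
        set T1 : Set (Fin 2 → ℝ) := {p | p ∈ Sg ∧ R₁.eval (p 0) ≠ 0} with hT1
        have hsplit : Sg = T0 ∪ T1 := by
          ext p; simp only [hT0, hT1, Set.mem_union, Set.mem_setOf_eq]; tauto
        have hT0c : T0.ncard ≤ 3 * R₁.support.card :=
          fibre_three_le_gen a₃ a₂ a₁ a₀ R₁ hR1 T0
            (fun p hp => ⟨hpos0 p hp.1.1, hp.2, hcub p hp.1.1, hnv p hp.1.1⟩)
        have hT1c : T1.ncard ≤ N'.support.card := by
          by_cases hN'z : N' = 0
          · have hT1e : T1 = ∅ := by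
              rcases Set.eq_empty_or_nonempty T1 with h | ⟨p, hp⟩
              · exact h
              exfalso
              have hR1p : R₁.eval (p 0) ≠ 0 := hp.2
              have hap : a₃.eval (p 0) ≠ 0 := hp.1.2
              have hlin := hRlin p hp.1.1
              have hb := hpos1 p hp.1.1
              apply hfin.not_infinite
              have hc : Continuous fun t => R₀.eval t * R₁.eval t := R₀.continuous.mul R₁.continuous
              refine OsculationCusp.infinite_of_curve
                (U := {t | 0 < t ∧ R₀.eval t * R₁.eval t < 0} ∩ {t : ℝ | a₃.eval t ≠ 0})
                (((isOpen_lt continuous_const continuous_id).inter (isOpen_lt hc continuous_const)).inter hVa)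
                (t₀ := p 0) ⟨⟨hpos0 p hp.1.1, ?_⟩, hap⟩ (fun t => -(R₀.eval t) / R₁.eval t) ?_
              · have h0 : R₀.eval (p 0) = -(R₁.eval (p 0) * p 1) := by linarith
                rw [h0]
                nlinarith [mul_self_pos.2 hR1p]
              · intro t ht
                obtain ⟨⟨htpos, hprod⟩, hat⟩ := ht
                have hR1t : R₁.eval t ≠ 0 := by
                  intro h0; rw [h0, mul_zero] at hprod; exact lt_irrefl _ hprod
                have hq : R₁.eval t * (-(R₀.eval t) / R₁.eval t) + R₀.eval t = 0 := by
                  field_simp; ring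
                have hcubt : a₃.eval t * (-(R₀.eval t) / R₁.eval t) ^ 3 + a₂.eval t * (-(R₀.eval t) / R₁.eval t) ^ 2
                    + a₁.eval t * (-(R₀.eval t) / R₁.eval t) + a₀.eval t = 0 := by
                  have hN't : N'.eval t = 0 := by rw [hN'z, eval_zero]
                  rw [hN'q t _ hq] at hN't
                  exact (mul_eq_zero.1 hN't).resolve_left (pow_ne_zero 3 hR1t)
                have hbpos : 0 < -(R₀.eval t) / R₁.eval t := by
                  have h1 : -(R₀.eval t) / R₁.eval t = (-(R₀.eval t * R₁.eval t)) / (R₁.eval t * R₁.eval t) := by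
                    field_simp
                  rw [h1]
                  exact div_pos (by linarith) (mul_self_pos.2 hR1t)
                refine hin t _ htpos hbpos hat hcubt ?_
                rw [hR2, eval_zero, zero_mul, zero_add]
                exact hq
            rw [hT1e, Set.ncard_empty]; exact Nat.zero_le _
          · refine inj_le N' hN'z T1 (fun p hp => ⟨hpos0 p hp.1.1, hN'root p hp.1.1⟩) ?_
            intro p hp q hq hpq
            have h1 := hRlin p hp.1.1
            have h2 := hRlin q hq.1.1
            rw [← hpq] at h2
            have h3 : R₁.eval (p 0) * (p 1 - q 1) = 0 := by linarith
            rcases mul_eq_zero.1 h3 with h | h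
            · exact absurd h hp.2
            · linarith
        calc Sg.ncard = (T0 ∪ T1).ncard := by rw [← hsplit]
          _ ≤ T0.ncard + T1.ncard := Set.ncard_union_le _ _
          _ ≤ 3 * R₁.support.card + N'.support.card := Nat.add_le_add hT0c hT1c
          _ ≤ _ := by
              nlinarith [Nat.zero_le N.support.card, Nat.zero_le R₂.support.card, Nat.zero_le R₀.support.card,
                Nat.zero_le L₁.support.card, Nat.zero_le L₀.support.card]
    · /- QUADRATIC REGIME `R₂ ≢ 0` -/
      set S0 : Set (Fin 2 → ℝ) := {p | p ∈ Sg ∧ R₂.eval (p 0) = 0} with hS0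
      set S1 : Set (Fin 2 → ℝ) := {p | p ∈ Sg ∧ R₂.eval (p 0) ≠ 0 ∧ L₁.eval (p 0) ≠ 0} with hS1
      set S2 : Set (Fin 2 → ℝ) := {p | p ∈ Sg ∧ R₂.eval (p 0) ≠ 0 ∧ L₁.eval (p 0) = 0} with hS2
      have hsplit : Sg = S0 ∪ S1 ∪ S2 := by
        ext p; simp only [hS0, hS1, hS2, Set.mem_union, Set.mem_setOf_eq]; tauto
      have hS0c : S0.ncard ≤ 3 * R₂.support.card :=
        fibre_three_le_gen a₃ a₂ a₁ a₀ R₂ hR2 S0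
          (fun p hp => ⟨hpos0 p hp.1.1, hp.2, hcub p hp.1.1, hnv p hp.1.1⟩)
      have hS1c : S1.ncard ≤ N.support.card := by
        by_cases hNz : N = 0
        · have hS1e : S1 = ∅ := by
            rcases Set.eq_empty_or_nonempty S1 with h | ⟨p, hp⟩
            · exact h
            exfalso
            have hR2p : R₂.eval (p 0) ≠ 0 := hp.2.1
            have hL1p : L₁.eval (p 0) ≠ 0 := hp.2.2
            have hap : a₃.eval (p 0) ≠ 0 := hp.1.2
            have hlin := hL p hp.1.1
            have hb := hpos1 p hp.1.1
            apply hfin.not_infinite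
            have hc : Continuous fun t => L₀.eval t * L₁.eval t := L₀.continuous.mul L₁.continuous
            have hV : IsOpen {t : ℝ | R₂.eval t ≠ 0} := isOpen_ne_fun R₂.continuous continuous_const
            refine OsculationCusp.infinite_of_curve
              (U := ({t | 0 < t ∧ L₀.eval t * L₁.eval t < 0} ∩ {t : ℝ | R₂.eval t ≠ 0}) ∩ {t : ℝ | a₃.eval t ≠ 0})
              ((((isOpen_lt continuous_const continuous_id).inter (isOpen_lt hc continuous_const)).inter hV).inter
                hVa)
              (t₀ := p 0) ⟨⟨⟨hpos0 p hp.1.1, ?_⟩, hR2p⟩, hap⟩ (fun t => -(L₀.eval t) / L₁.eval t) ?_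
            · have h0 : L₀.eval (p 0) = -(L₁.eval (p 0) * p 1) := by linarith
              rw [h0]
              nlinarith [mul_self_pos.2 hL1p]
            · intro t ht
              obtain ⟨⟨⟨htpos, hprod⟩, hR2t⟩, hat⟩ := ht
              have hL1t : L₁.eval t ≠ 0 := by
                intro h0; rw [h0, mul_zero] at hprod; exact lt_irrefl _ hprod
              have hl : L₁.eval t * (-(L₀.eval t) / L₁.eval t) + L₀.eval t = 0 := by
                field_simp; ring
              have hq : R₂.eval t * (-(L₀.eval t) / L₁.eval t) ^ 2 + R₁.eval t * (-(L₀.eval t) / L₁.eval t)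
                  + R₀.eval t = 0 := by
                have hNt : N.eval t = 0 := by rw [hNz, eval_zero]
                rw [hNq t _ hl] at hNt
                exact (mul_eq_zero.1 hNt).resolve_left (pow_ne_zero 2 hL1t)
              have hcubt : a₃.eval t * (-(L₀.eval t) / L₁.eval t) ^ 3 + a₂.eval t * (-(L₀.eval t) / L₁.eval t) ^ 2
                  + a₁.eval t * (-(L₀.eval t) / L₁.eval t) + a₀.eval t = 0 := by
                have h := hEuclid t (-(L₀.eval t) / L₁.eval t)
                rw [hq, hl, mul_zero, zero_add] at h
                exact (mul_eq_zero.1 h).resolve_left (pow_ne_zero 2 hR2t)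
              have hbpos : 0 < -(L₀.eval t) / L₁.eval t := by
                have h1 : -(L₀.eval t) / L₁.eval t = (-(L₀.eval t * L₁.eval t)) / (L₁.eval t * L₁.eval t) := by
                  field_simp
                rw [h1]
                exact div_pos (by linarith) (mul_self_pos.2 hL1t)
              exact hin t _ htpos hbpos hat hcubt hq
          rw [hS1e, Set.ncard_empty]; exact Nat.zero_le _
        · refine inj_le N hNz S1 (fun p hp => ⟨hpos0 p hp.1.1, hNroot p hp.1.1⟩) ?_
          intro p hp q hq hpq
          have h1 := hL p hp.1.1
          have h2 := hL q hq.1.1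
          rw [← hpq] at h2
          have h3 : L₁.eval (p 0) * (p 1 - q 1) = 0 := by linarith
          rcases mul_eq_zero.1 h3 with h | h
          · exact absurd h hp.2.2
          · linarith
      have hS2c : S2.ncard ≤ 3 * (L₁.support.card + L₀.support.card) := by
        by_cases hL1z : L₁ = 0
        · have hL0v : ∀ p ∈ osc, L₀.eval (p 0) = 0 := by
            intro p hp; have h := hL p hp; rw [hL1z, eval_zero, zero_mul, zero_add] at h; exact h
          by_cases hL0z : L₀ = 0
          · have hS2e : S2 = ∅ := by
              rcases Set.eq_empty_or_nonempty S2 with h | ⟨p, hp⟩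
              · exact h
              exfalso
              have hR2p : R₂.eval (p 0) ≠ 0 := hp.2.1
              have hap : a₃.eval (p 0) ≠ 0 := hp.1.2
              have hb := hpos1 p hp.1.1
              have hid : ∀ t b : ℝ, R₂.eval t ^ 2 * (a₃.eval t * b ^ 3 + a₂.eval t * b ^ 2 + a₁.eval t * b + a₀.eval t) =
                  (a₃.eval t * R₂.eval t * b + (a₂.eval t * R₂.eval t - a₃.eval t * R₁.eval t))
                    * (R₂.eval t * b ^ 2 + R₁.eval t * b + R₀.eval t) := by
                intro t b
                have h := hEuclid t b
                rw [hL1z, hL0z, eval_zero, zero_mul, add_zero, add_zero] at h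
                exact h
              have hD : ∀ t : ℝ, a₃.eval t ≠ 0 → R₂.eval t ≠ 0 → 0 ≤ R₁.eval t ^ 2 - 4 * R₂.eval t * R₀.eval t :=
                fun t hat ht => disc_nonneg_of_factor_gen hat ht (hreal t hat) (hid t)
              obtain ⟨ε, hε, hpε⟩ : ∃ ε : ℝ, (ε = 1 ∨ ε = -1) ∧
                  p 1 = (-R₁.eval (p 0) + ε * Real.sqrt (R₁.eval (p 0) ^ 2 - 4 * R₂.eval (p 0) * R₀.eval (p 0)))
                    / (2 * R₂.eval (p 0)) := by
                rcases root_formula hR2p (hD _ hap hR2p) (hR p hp.1.1) with h | h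
                · exact ⟨1, Or.inl rfl, by rw [one_mul]; exact h⟩
                · exact ⟨-1, Or.inr rfl, by rw [neg_one_mul, ← sub_eq_add_neg]; exact h⟩
              set ρ : ℝ → ℝ := fun t =>
                (-R₁.eval t + ε * Real.sqrt (R₁.eval t ^ 2 - 4 * R₂.eval t * R₀.eval t)) / (2 * R₂.eval t) with hρ
              have hV : IsOpen ({t : ℝ | R₂.eval t ≠ 0} ∩ {t : ℝ | a₃.eval t ≠ 0}) :=
                (isOpen_ne_fun R₂.continuous continuous_const).inter hVa
              have hρc : ContinuousOn ρ ({t : ℝ | R₂.eval t ≠ 0} ∩ {t : ℝ | a₃.eval t ≠ 0}) := by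
                have hnum : Continuous fun t => -R₁.eval t
                    + ε * Real.sqrt (R₁.eval t ^ 2 - 4 * R₂.eval t * R₀.eval t) :=
                  R₁.continuous.neg.add (continuous_const.mul
                    (((R₁.continuous.pow 2).sub ((continuous_const.mul R₂.continuous).mul R₀.continuous)).sqrt))
                have hden : Continuous fun t => 2 * R₂.eval t := continuous_const.mul R₂.continuous
                exact hnum.continuousOn.div hden.continuousOn (fun t ht => mul_ne_zero two_ne_zero ht.1)
              apply hfin.not_infinite
              refine OsculationCusp.infinite_of_curve
                (U := Set.Ioi 0 ∩ (({t : ℝ | R₂.eval t ≠ 0} ∩ {t : ℝ | a₃.eval t ≠ 0}) ∩ ρ ⁻¹' Set.Ioi 0))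
                (isOpen_Ioi.inter (hρc.isOpen_inter_preimage hV isOpen_Ioi))
                (t₀ := p 0) ⟨hpos0 p hp.1.1, ⟨hR2p, hap⟩, ?_⟩ ρ ?_
              · show 0 < ρ (p 0)
                rw [hρ]; dsimp only; rw [← hpε]; exact hb
              · intro t ht
                obtain ⟨htpos, ⟨hR2t, hat⟩, hρpos⟩ := ht
                have hq : R₂.eval t * ρ t ^ 2 + R₁.eval t * ρ t + R₀.eval t = 0 := by
                  rw [hρ]; exact root_of_formula hR2t (hD t hat hR2t) hε
                have hcubt : a₃.eval t * ρ t ^ 3 + a₂.eval t * ρ t ^ 2 + a₁.eval t * ρ t + a₀.eval t = 0 := by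
                  have h := hid t (ρ t)
                  rw [hq, mul_zero] at h
                  exact (mul_eq_zero.1 h).resolve_left (pow_ne_zero 2 hR2t)
                exact hin t (ρ t) htpos hρpos hat hcubt hq
            rw [hS2e, Set.ncard_empty]; exact Nat.zero_le _
          · have h := fibre_three_le_gen a₃ a₂ a₁ a₀ L₀ hL0z S2
              (fun p hp => ⟨hpos0 p hp.1.1, hL0v p hp.1.1, hcub p hp.1.1, hnv p hp.1.1⟩)
            nlinarith [h, Nat.zero_le L₁.support.card]
        · have h := fibre_three_le_gen a₃ a₂ a₁ a₀ L₁ hL1z S2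
            (fun p hp => ⟨hpos0 p hp.1.1, hp.2.2, hcub p hp.1.1, hnv p hp.1.1⟩)
          nlinarith [h, Nat.zero_le L₀.support.card]
      calc Sg.ncard = (S0 ∪ S1 ∪ S2).ncard := by rw [← hsplit]
        _ ≤ (S0 ∪ S1).ncard + S2.ncard := Set.ncard_union_le _ _
        _ ≤ S0.ncard + S1.ncard + S2.ncard := Nat.add_le_add_right (Set.ncard_union_le _ _) _
        _ ≤ 3 * R₂.support.card + N.support.card + 3 * (L₁.support.card + L₀.support.card) :=
            Nat.add_le_add (Nat.add_le_add hS0c hS1c) hS2c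
        _ ≤ _ := by
            nlinarith [Nat.zero_le N'.support.card, Nat.zero_le R₁.support.card, Nat.zero_le R₀.support.card]
  calc osc.ncard = (Sa ∪ Sg).ncard := by rw [← hsplit0]
    _ ≤ Sa.ncard + Sg.ncard := Set.ncard_union_le _ _
    _ ≤ 3 * a₃.support.card + (N.support.card + N'.support.card
          + 3 * (R₂.support.card + R₁.support.card + R₀.support.card + L₁.support.card + L₀.support.card)) :=
        Nat.add_le_add hSac hSgc
    _ = _ := by ring

end OsculationCuspCubic

end Summit.ValiantsHypothesis.ValiantsHypothesis.Theorems.LacunarySymmetroidMatrixDescartes
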